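import Summits.QuantumFields.BalabanUV.Beta.GAN24.CombBornBorderLineage
import Summits.QuantumFields.BalabanUV.Beta.GAN24.BornBorderLetters

/-!
# The (III′) V-born sector with the UNDRESSED lineages READ ON THE RAW sym border table `cVH • tabs.V` (not on its transport `𝒯 (cVH • tabs.V)`): the split
# source + raw-undressed + contact and the socket `hV ⟸ hUv⁰ ∧ hCv⁰` — the companion of M.61 `CombBornBorderLetters` that puts ALL the comb-chart-specific content
# (the transport `𝒯 = Ψ̂ᵀ ∘ slotPsiS ∘ Ψ̂` of the source AND the conjugated legs) into the CONTACT letter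

NOT IN PRINT — OUR BOOKKEEPING (road-P2 = `b2b-balaban-gan24-p2` gen 56, 2026-08-25; row G-an2-4 ∕ (CONV-C), the (α-0) chain at row D1's literal
OF RECORD (III′) `JsB12CombShSym`; [folklore] composition BY NAME; 0 `def`, 0 cite, 0 `def … : Prop`, 0 `sorry`).  Weight 0.  NEVER «G-an2-4 closed» as (CONV-C);
NOT D1, NOT BetaPertH, NOT continuum, NOT Clay; NO campaign opened (an2 W-4).

WHY (road-P2 MEMO M-gan24p2-g56-1 §2(b)): M.61's undressed V lineages read the TRANSPORTED border `𝒱`, which has no finite `Near` support, so road S3's rooted V rows do not price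
them by name; with the undressed term taken on the RAW table `cVH • tabs.V` instead (this file), the undressed letter `hUv⁰` is EXACTLY leaf-04 g57's (E)
`BornBorderDriftThree.exists_hUgV_three` shape with `vhSAt ρ ↦ tabs.V` — for the record's `tabs.V = symVhSAt ρ_c` a mkroot-style re-run of the OWNER's «ROOTED-S3-V» package
on an1's symmetrised border table (same (ρV-a) letters: `symVhKerAt_eq_zero_left ∕ _right`, `abs_symVhKerAt_le ≤ 3ℓ²` «the SAME constant as the comb's») — and the transport
defect `𝒯 − 1` (face insertions, M.55's object at level 0) joins the contact letter `hCv⁰`, where the OWNER's face-term words price it.  The identity below holds for ANY choice of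
the undressed term (`V + Σ U + Σ (D − U)`); only the bookkeeping changes.
* §1 **`unitS_combBornV_eq_source_add_rawUndressed_add_contact (hVff hVmm) (cE cVH k)`**:
  `unitS_k (combBornOf Lc tabs cE cVH 0 k) = cVH • tabs.V + Σ_{i<k} U⁰_{i,k} + Σ_{i<k} (D_{i,k} − U⁰_{i,k})`, `U⁰_{i,k} := w^{k−i} • push₃ B_{i+1,k}³ (−(push₃ (−R⁰_i) (colM K̃_i Lc) R⁰_i
  (reslot inl inr (cVH • tabs.V)) + push₃ (rowMM K̃_i Lc) R⁰_i R⁰_i (reslot inr inl (cVH • tabs.V))))` — leaf-01 g60's (E) undressed term VERBATIM with `vhSAt ρ ↦ tabs.V`;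
  `D_{i,k} := transport combUnitStepMap (i+1) (k−1−i) (combUnitStepMap Lc cE i (cVH • tabs.V))` (M.56).
* §2 **`exists_hBv_of_rawLetters (hUv⁰ hCv⁰)`** : the letter `hV` of M.57 `exists_hB_of_sectors`; `exists_hUv_raw_of_geometric`, `exists_hCv_raw_of_geometric ∕ _of_polyGeometric`,
  **`exists_hBv_of_rawGeometric`**, **`exists_hBv_of_rawGeometric_poly`** (leaf-01's `locStencil_sum_of_geometric` ∕ leaf-03's `locStencil_sum_of_polyGeometric` BY NAME).
Discharges NO letter but the V-source's (M.56 `exists_hX_v`); NO estimate; NO value ∕ rate of Bałaban's tables.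
-/

noncomputable section

open Finset
open scoped BigOperators
open Literature.MathematicalPhysics.QuantumFieldTheory
open Literature.MathematicalPhysics.QuantumFieldTheory.Balaban1983to89
open Literature.MathematicalPhysics.QuantumFieldTheory.Balaban1983to89.Beta
open ExpKernelCalculus (MKer)
open AffineAveraging (Site box toSite)
open OneStepResolventKernel (Fib LocStencil)
open StepJetData (locStencil_add)
open BalabanStepJets (locStencil_mono)
open BalabanCompositeJets (respStep)
open Summit.QuantumFields.BalabanUV.Beta.HessKerDressedUnits (unitS)
open Summit.QuantumFields.BalabanUV.Beta.SymmetrisedStepJets (SymTables)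
open Summit.QuantumFields.BalabanUV.Beta.GAN24.CombesThomas (sfStep smStep KStepUnit)
open Summit.QuantumFields.BalabanUV.Beta.GAN24.Push3 (push₃)
open Summit.QuantumFields.BalabanUV.Beta.GAN24.AffineUnroll (transport)
open Summit.QuantumFields.BalabanUV.Beta.GAN24.SrecLinearPartEq (colM rowMM reslot)
open Summit.QuantumFields.BalabanUV.Beta.GAN24.BornLambdaLetters (locStencil_sum_of_geometric)
open Summit.QuantumFields.BalabanUV.Beta.GAN24.BornLambdaLettersPoly (locStencil_sum_of_polyGeometric)
open Summit.QuantumFields.BalabanUV.Beta.GAN24.CombWilsonSector (combBornOf)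
open Summit.QuantumFields.BalabanUV.Beta.GAN24.CombBornSector (combFreshAt combUnitStepMap)
open Summit.QuantumFields.BalabanUV.Beta.GAN24.CombBornBorderLineage (unitS_combBornV_eq_sum exists_hX_v unitS_combFreshAt_v)

namespace Summit.QuantumFields.BalabanUV.Beta.GAN24.CombBornBorderLettersRaw

variable {d : ℕ} {Lc : ℕ} [NeZero Lc] (tabs : SymTables d Lc) (hVff : ∀ κ u x y (α β : Fin (d + 1)), tabs.V κ u x y (Sum.inl α) (Sum.inl β) = 0)
  (hVmm : ∀ κ u x y (μ ν : Fin (d + 1)), tabs.V κ u x y (Sum.inr μ) (Sum.inr ν) = 0) (cE cVH : ℝ)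

/-- The (E)-shaped undressed one-step image of the RAW V-source (local notation): `Y⁰_i := −(push₃ (−R⁰_i) (colM K̃_i Lc) R⁰_i (reslot inl inr (cVH • tabs.V)) +
push₃ (rowMM K̃_i Lc) R⁰_i R⁰_i (reslot inr inl (cVH • tabs.V)))`, `R⁰_i = respStep (Lc^i) (Lc^(i+1))`. -/
local notation:max "Y⁰[" i "]" => (fun κ u => -(push₃ (-respStep (d := d) (Lc ^ i) (Lc ^ (i + 1))) (colM (KStepUnit (d := d) Lc i) Lc)
      (respStep (d := d) (Lc ^ i) (Lc ^ (i + 1))) (reslot Sum.inl Sum.inr fun κ u => cVH • SymTables.V tabs κ u) κ u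
    + push₃ (rowMM (KStepUnit (d := d) Lc i) Lc) (respStep (d := d) (Lc ^ i) (Lc ^ (i + 1)))
      (respStep (d := d) (Lc ^ i) (Lc ^ (i + 1))) (reslot Sum.inr Sum.inl fun κ u => cVH • SymTables.V tabs κ u) κ u))
/-- The undressed outer legs of the lineage born at `i`, read at `k` (local notation). -/
local notation:max "B[" i "," k "]" => respStep (d := d) (Lc ^ (i + 1)) (Lc ^ k)

/-! ## §1 Member `k`: source + RAW undressed lineages + contact terms -/

include hVff hVmm in
/-- NOT IN PRINT; OUR BOOKKEEPING ((III′) V sector, instance side, RAW-table bookkeeping; [folklore]).  **THE (III′) V-BORN REMAINDER IN UNITS = SOURCE + RAW UNDRESSED LINEAGES +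
CONTACT TERMS**: with `X_i := combUnitStepMap Lc cE i (cVH • tabs.V)`, `D_{i,k} := transport combUnitStepMap (i+1) (k−1−i) X_i` and the RAW undressed lineage
`U⁰_{i,k} := w^{k−i} • push₃ B_{i+1,k}³ Y⁰_i` (leaf-01's (E) undressed term with `vhSAt ρ ↦ tabs.V` — NO transport, NO `ψ♭`),
`unitS_k (combBornOf Lc tabs cE cVH 0 k) = cVH • tabs.V + Σ_{i<k} U⁰_{i,k} + Σ_{i<k} (D_{i,k} − U⁰_{i,k})`.  Each summand of the last sum is the contact term of one lineage — it now
contains the transport defect of the source (`𝒯 − 1`: face insertions) as well as the leg telescope `T″ − B`. -/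
theorem unitS_combBornV_eq_source_add_rawUndressed_add_contact (k : ℕ) :
    unitS (sfStep Lc k) (smStep d Lc k) (combBornOf Lc tabs cE cVH 0 k)
      = (fun κ u => cVH • tabs.V κ u)
        + ∑ i ∈ Finset.range k, (fun κ' u' => (cE * (Lc : ℝ) ^ (2 * (d + 1))) ^ (k - i) • push₃ B[i, k] B[i, k] B[i, k] Y⁰[i] κ' u')
        + ∑ i ∈ Finset.range k, (transport (combUnitStepMap Lc cE) (i + 1) (k - 1 - i) (combUnitStepMap Lc cE i (fun κ u => cVH • tabs.V κ u))
            - fun κ' u' => (cE * (Lc : ℝ) ^ (2 * (d + 1))) ^ (k - i) • push₃ B[i, k] B[i, k] B[i, k] Y⁰[i] κ' u') := by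
  rw [unitS_combBornV_eq_sum tabs hVff hVmm cE cVH k, add_assoc, ← Finset.sum_add_distrib]
  congr 1
  refine Finset.sum_congr rfl fun i _ => ?_
  abel

/-! ## §2 The socket `hV ⟸ hUv⁰ ∧ hCv⁰` and its per-lineage forms -/

include hVff hVmm in
/-- NOT IN PRINT; OUR BOOKKEEPING ((III′) socket, V sector, RAW-table bookkeeping).  **THE (III′) V-BORN ROW FROM TWO LETTERS**: a `k`-uniform `LocStencil` letter for the RAW
undressed V lineages summed over the birth levels (`hUv⁰` — the (E) `hUv` shape on `tabs.V`) and one for the contact terms (`hCv⁰`) give the letter `hV` of M.57 `exists_hB_of_sectors`;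
the source letter is M.56's `exists_hX_v` at the common rate. -/
theorem exists_hBv_of_rawLetters
    (hU : ∃ C δ : ℝ, 0 < δ ∧ ∀ k : ℕ,
      LocStencil (∑ i ∈ Finset.range k, fun κ' u' => (cE * (Lc : ℝ) ^ (2 * (d + 1))) ^ (k - i) • push₃ B[i, k] B[i, k] B[i, k] Y⁰[i] κ' u') C δ)
    (hC : ∃ C δ : ℝ, 0 < δ ∧ ∀ k : ℕ,
      LocStencil (∑ i ∈ Finset.range k, (transport (combUnitStepMap Lc cE) (i + 1) (k - 1 - i) (combUnitStepMap Lc cE i (fun κ u => cVH • tabs.V κ u))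
        - fun κ' u' => (cE * (Lc : ℝ) ^ (2 * (d + 1))) ^ (k - i) • push₃ B[i, k] B[i, k] B[i, k] Y⁰[i] κ' u')) C δ) :
    ∃ C δ : ℝ, 0 < δ ∧ ∀ k : ℕ, LocStencil (unitS (sfStep Lc k) (smStep d Lc k) (combBornOf Lc tabs cE cVH 0 k)) C δ := by
  obtain ⟨CU, δU, hδU, hU⟩ := hU
  obtain ⟨CC, δC, hδC, hC⟩ := hC
  have hδ : 0 < min δU δC := lt_min hδU hδC
  obtain ⟨CV, hV⟩ := exists_hX_v tabs hVff hVmm cVH hδ.le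
  refine ⟨|cVH| * CV + CU + CC, min δU δC, hδ, fun k => ?_⟩
  have hCU : 0 ≤ CU := ((hU k) 0 0).nonneg (Sum.inl 0)
  have hCC : 0 ≤ CC := ((hC k) 0 0).nonneg (Sum.inl 0)
  have h1 := hV 0
  rw [unitS_combFreshAt_v tabs hVff hVmm] at h1
  rw [unitS_combBornV_eq_source_add_rawUndressed_add_contact tabs hVff hVmm cE cVH k]
  have h2 := locStencil_mono (hU k) hCU (min_le_left δU δC)
  have h3 := locStencil_mono (hC k) hCC (min_le_right δU δC)
  exact locStencil_add (locStencil_add h1 h2) h3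

omit [NeZero Lc] in
/-- NOT IN PRINT; OUR BOOKKEEPING.  **THE RAW UNDRESSED-LINEAGE LETTER `hUv⁰` FROM A PER-LINEAGE GEOMETRIC LETTER** — the per-lineage letter is leaf-04 g57's (E)
`BornBorderDriftThree.exists_hUgV_three` conclusion with `vhSAt (toSite rr) ↦ tabs.V` (no root quantifier). -/
theorem exists_hUv_raw_of_geometric [NeZero Lc]
    (hUg : ∃ C θ δ : ℝ, 0 ≤ C ∧ 0 ≤ θ ∧ θ < 1 ∧ 0 < δ ∧ ∀ k i : ℕ, i < k →
      LocStencil (fun κ' u' => (cE * (Lc : ℝ) ^ (2 * (d + 1))) ^ (k - i) • push₃ B[i, k] B[i, k] B[i, k] Y⁰[i] κ' u') (C * θ ^ (k - i)) δ) :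
    ∃ C δ : ℝ, 0 < δ ∧ ∀ k : ℕ,
      LocStencil (∑ i ∈ Finset.range k, fun κ' u' => (cE * (Lc : ℝ) ^ (2 * (d + 1))) ^ (k - i) • push₃ B[i, k] B[i, k] B[i, k] Y⁰[i] κ' u') C δ := by
  obtain ⟨C, θ, δ, hC0, hθ0, hθ1, hδ, h⟩ := hUg
  exact ⟨C * (θ / (1 - θ)), δ, hδ, fun k => locStencil_sum_of_geometric hC0 hθ0 hθ1 k fun i hi => h k i hi⟩

/-- NOT IN PRINT; OUR BOOKKEEPING.  **THE CONTACT LETTER `hCv⁰` FROM A PER-LINEAGE GEOMETRIC LETTER** (no logs). -/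
theorem exists_hCv_raw_of_geometric
    (hCg : ∃ C θ δ : ℝ, 0 ≤ C ∧ 0 ≤ θ ∧ θ < 1 ∧ 0 < δ ∧ ∀ k i : ℕ, i < k →
      LocStencil (transport (combUnitStepMap Lc cE) (i + 1) (k - 1 - i) (combUnitStepMap Lc cE i (fun κ u => cVH • tabs.V κ u))
        - fun κ' u' => (cE * (Lc : ℝ) ^ (2 * (d + 1))) ^ (k - i) • push₃ B[i, k] B[i, k] B[i, k] Y⁰[i] κ' u') (C * θ ^ (k - i)) δ) :
    ∃ C δ : ℝ, 0 < δ ∧ ∀ k : ℕ,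
      LocStencil (∑ i ∈ Finset.range k, (transport (combUnitStepMap Lc cE) (i + 1) (k - 1 - i) (combUnitStepMap Lc cE i (fun κ u => cVH • tabs.V κ u))
        - fun κ' u' => (cE * (Lc : ℝ) ^ (2 * (d + 1))) ^ (k - i) • push₃ B[i, k] B[i, k] B[i, k] Y⁰[i] κ' u')) C δ := by
  obtain ⟨C, θ, δ, hC0, hθ0, hθ1, hδ, h⟩ := hCg
  exact ⟨C * (θ / (1 - θ)), δ, hδ, fun k => locStencil_sum_of_geometric hC0 hθ0 hθ1 k fun i hi => h k i hi⟩

/-- NOT IN PRINT; OUR BOOKKEEPING.  **THE CONTACT LETTER `hCv⁰` FROM A PER-LINEAGE LETTER WITH LOGS** `C·(k−i)^p·θ^{k−i}` (leaf-03's `locStencil_sum_of_polyGeometric`). -/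
theorem exists_hCv_raw_of_polyGeometric (p : ℕ)
    (hCg : ∃ C θ δ : ℝ, 0 ≤ C ∧ 0 ≤ θ ∧ θ < 1 ∧ 0 < δ ∧ ∀ k i : ℕ, i < k →
      LocStencil (transport (combUnitStepMap Lc cE) (i + 1) (k - 1 - i) (combUnitStepMap Lc cE i (fun κ u => cVH • tabs.V κ u))
        - fun κ' u' => (cE * (Lc : ℝ) ^ (2 * (d + 1))) ^ (k - i) • push₃ B[i, k] B[i, k] B[i, k] Y⁰[i] κ' u') (C * (((k - i : ℕ) : ℝ) ^ p * θ ^ (k - i))) δ) :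
    ∃ C δ : ℝ, 0 < δ ∧ ∀ k : ℕ,
      LocStencil (∑ i ∈ Finset.range k, (transport (combUnitStepMap Lc cE) (i + 1) (k - 1 - i) (combUnitStepMap Lc cE i (fun κ u => cVH • tabs.V κ u))
        - fun κ' u' => (cE * (Lc : ℝ) ^ (2 * (d + 1))) ^ (k - i) • push₃ B[i, k] B[i, k] B[i, k] Y⁰[i] κ' u')) C δ := by
  obtain ⟨C, θ, δ, hC0, hθ0, hθ1, hδ, h⟩ := hCg
  exact ⟨C * ((p.factorial : ℝ) * θ / (1 - θ) ^ (p + 1)), δ, hδ, fun k =>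
    locStencil_sum_of_polyGeometric p hC0 hθ0 hθ1 k fun i hi => h k i hi⟩

include hVff hVmm in
/-- NOT IN PRINT; OUR BOOKKEEPING ((III′) V half, END SHAPE, RAW-table bookkeeping, generic `d`).  **THE (III′) V-BORN ROW FROM TWO PER-LINEAGE GEOMETRIC LETTERS** — the RAW undressed
letter (the (E) `hUgV` shape on `tabs.V`) and the contact letter (now carrying `𝒯 − 1` and `T″ − B`). -/
theorem exists_hBv_of_rawGeometric
    (hUg : ∃ C θ δ : ℝ, 0 ≤ C ∧ 0 ≤ θ ∧ θ < 1 ∧ 0 < δ ∧ ∀ k i : ℕ, i < k →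
      LocStencil (fun κ' u' => (cE * (Lc : ℝ) ^ (2 * (d + 1))) ^ (k - i) • push₃ B[i, k] B[i, k] B[i, k] Y⁰[i] κ' u') (C * θ ^ (k - i)) δ)
    (hCg : ∃ C θ δ : ℝ, 0 ≤ C ∧ 0 ≤ θ ∧ θ < 1 ∧ 0 < δ ∧ ∀ k i : ℕ, i < k →
      LocStencil (transport (combUnitStepMap Lc cE) (i + 1) (k - 1 - i) (combUnitStepMap Lc cE i (fun κ u => cVH • tabs.V κ u))
        - fun κ' u' => (cE * (Lc : ℝ) ^ (2 * (d + 1))) ^ (k - i) • push₃ B[i, k] B[i, k] B[i, k] Y⁰[i] κ' u') (C * θ ^ (k - i)) δ) :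
    ∃ C δ : ℝ, 0 < δ ∧ ∀ k : ℕ, LocStencil (unitS (sfStep Lc k) (smStep d Lc k) (combBornOf Lc tabs cE cVH 0 k)) C δ :=
  exists_hBv_of_rawLetters tabs hVff hVmm cE cVH (exists_hUv_raw_of_geometric tabs cE cVH hUg) (exists_hCv_raw_of_geometric tabs cE cVH hCg)

include hVff hVmm in
/-- NOT IN PRINT; OUR BOOKKEEPING ((III′) V half, END SHAPE with logs in the contact letter). -/
theorem exists_hBv_of_rawGeometric_poly (p : ℕ)
    (hUg : ∃ C θ δ : ℝ, 0 ≤ C ∧ 0 ≤ θ ∧ θ < 1 ∧ 0 < δ ∧ ∀ k i : ℕ, i < k →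
      LocStencil (fun κ' u' => (cE * (Lc : ℝ) ^ (2 * (d + 1))) ^ (k - i) • push₃ B[i, k] B[i, k] B[i, k] Y⁰[i] κ' u') (C * θ ^ (k - i)) δ)
    (hCg : ∃ C θ δ : ℝ, 0 ≤ C ∧ 0 ≤ θ ∧ θ < 1 ∧ 0 < δ ∧ ∀ k i : ℕ, i < k →
      LocStencil (transport (combUnitStepMap Lc cE) (i + 1) (k - 1 - i) (combUnitStepMap Lc cE i (fun κ u => cVH • tabs.V κ u))
        - fun κ' u' => (cE * (Lc : ℝ) ^ (2 * (d + 1))) ^ (k - i) • push₃ B[i, k] B[i, k] B[i, k] Y⁰[i] κ' u') (C * (((k - i : ℕ) : ℝ) ^ p * θ ^ (k - i))) δ) :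
    ∃ C δ : ℝ, 0 < δ ∧ ∀ k : ℕ, LocStencil (unitS (sfStep Lc k) (smStep d Lc k) (combBornOf Lc tabs cE cVH 0 k)) C δ :=
  exists_hBv_of_rawLetters tabs hVff hVmm cE cVH (exists_hUv_raw_of_geometric tabs cE cVH hUg) (exists_hCv_raw_of_polyGeometric tabs cE cVH p hCg)

end Summit.QuantumFields.BalabanUV.Beta.GAN24.CombBornBorderLettersRaw

end
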